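import Literature.Topology.FourManifolds.CuspLocusArc
import HarnessLib

/-!
# A generic map is injective on its critical set near a cusp

Topic `Literature/Topology/FourManifolds` (programme of the fact
`Literature.Topology.FourManifolds.exists_isSimplifiedBrokenLefschetzFibration`, Baykur–Saeki 2017, §2.1,
p. 6: "`f|_{C_f}` is an immersion with normal crossings away from the cusps" presupposes that
the two fold branches emanating from a cusp do not meet near the cusp).  In Whitney cusp
charts the critical set is the arc `x ↦ (τ(x), x, 0, 0)` (`CuspLocusArc`) and its image is the
plane curve `x ↦ (τ(x), λ(x))`, `λ(x) = h(τ(x), x)`.  Differentiating `h_x(τ(x), x) = 0` gives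
`λ' = τ' · h_t(τ, x) = -h_xx(τ, x) h_t(τ, x) / h_tx(τ, x)`, and the Whitney conditions
(`h_t(0) = h_xx(0) = 0`, `h_tx(0) ≠ 0`, `h_xxx(0) ≠ 0`) make `λ'(x) ∼ -h_xxx(0) x²`: `λ` is
strictly monotone near `0`, so the image curve — hence `g` on its critical set near the cusp —
is injective.

* `exists_injOn_cuspValue` (the planar computation);
* `HasManifoldWhitneyCuspCharts.exists_nhds_injOn` (the manifold statement).

Everything is proved; no definitions, no named facts (D-0026).

## References

* R. İ. Baykur, O. Saeki, *Simplifying indefinite fibrations on 4-manifolds*, arXiv:1705.11169,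
  §2.1, p. 6. [BaykurSaeki2017]
* M. Golubitsky, V. Guillemin, *Stable Mappings and Their Singularities*, GTM 14 (1973), Ch. VI
  §2 (Whitney cusp). [GolubitskyGuillemin1973]
-/

noncomputable section

set_option maxSynthPendingDepth 2

open Set Function Filter Module Metric
open scoped ContDiff Topology Manifold

namespace Literature.Topology.FourManifolds

/-- Local notation: `𝔼 n` is the model Euclidean space `EuclideanSpace ℝ (Fin n)`. -/
local notation "𝔼 " n:arg => EuclideanSpace ℝ (Fin n)

/-! ### Strict monotonicity from a derivative positive off one point -/

/-- A function continuous on `(-η, η)` with derivative `> 0` off `0` is injective there.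
[folklore] -/
theorem injOn_Ioo_of_deriv_pos_off_zero {μ : ℝ → ℝ} {η : ℝ}
    (hc : ContinuousOn μ (Ioo (-η) η))
    (hd : ∀ t ∈ Ioo (-η) η, t ≠ 0 → 0 < deriv μ t) : InjOn μ (Ioo (-η) η) := by
  have h1 : StrictMonoOn μ (Ioc (-η) 0 ∩ Ioo (-η) η) := by
    refine strictMonoOn_of_deriv_pos ((convex_Ioc _ _).inter (convex_Ioo _ _))
      (hc.mono inter_subset_right) fun t ht => ?_
    rw [interior_inter, interior_Ioc, interior_Ioo] at ht
    exact hd t ht.2 ht.1.2.ne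
  have h2 : StrictMonoOn μ (Ico 0 η ∩ Ioo (-η) η) := by
    refine strictMonoOn_of_deriv_pos ((convex_Ico _ _).inter (convex_Ioo _ _))
      (hc.mono inter_subset_right) fun t ht => ?_
    rw [interior_inter, interior_Ico, interior_Ioo] at ht
    exact hd t ht.2 ht.1.1.ne'
  have hmono : StrictMonoOn μ (Ioo (-η) η) := by
    intro a ha b hb hab
    rcases le_or_gt b 0 with hb0 | hb0
    · exact h1 ⟨⟨ha.1, (hab.le.trans hb0)⟩, ha⟩ ⟨⟨hb.1, hb0⟩, hb⟩ hab
    rcases le_or_gt 0 a with ha0 | ha0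
    · exact h2 ⟨⟨ha0, ha.2⟩, ha⟩ ⟨⟨ha0.trans hab.le, hb.2⟩, hb⟩ hab
    · have h0 : (0 : ℝ) ∈ Ioo (-η) η := ⟨by linarith [ha.1], by linarith [hb.2]⟩
      calc μ a < μ 0 := h1 ⟨⟨ha.1, ha0.le⟩, ha⟩ ⟨⟨h0.1, le_rfl⟩, h0⟩ ha0
        _ < μ b := h2 ⟨⟨le_rfl, h0.2⟩, h0⟩ ⟨⟨hb0.le, hb.2⟩, hb⟩ hb0
  exact hmono.injOn

/-! ### The planar computation -/

/-- **The cusp value curve is injective.**  Let `h` be `C^∞` near `0 ∈ ℝ²` with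
`h_t(0) = h_xx(0) = 0`, `h_tx(0) ≠ 0`, `h_xxx(0) ≠ 0`, and let `x ↦ τ(x)` be a `C^∞` solution
of `h_x(τ(x), x) = 0` near `0` with `τ(0) = 0` (the critical curve of the cusp model,
`exists_cuspCritCurve`).  Then `x ↦ h(τ(x), x)` is injective on a neighbourhood of `0`.
[cite: GolubitskyGuillemin1973, Ch. VI §2] [cite: BaykurSaeki2017, §2.1, p. 6] -/
theorem exists_injOn_cuspValue {h : ℝ × ℝ → ℝ} {U : Set (ℝ × ℝ)} (hU : IsOpen U)
    (h0 : (0 : ℝ × ℝ) ∈ U) (hh : ContDiffOn ℝ ∞ h U)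
    (ht : fderiv ℝ h 0 ((1 : ℝ), (0 : ℝ)) = 0)
    (hxx : fderiv ℝ (fderiv ℝ h) 0 ((0 : ℝ), (1 : ℝ)) ((0 : ℝ), (1 : ℝ)) = 0)
    (hxxx : fderiv ℝ (fderiv ℝ (fderiv ℝ h)) 0 ((0 : ℝ), (1 : ℝ)) ((0 : ℝ), (1 : ℝ))
      ((0 : ℝ), (1 : ℝ)) ≠ 0)
    (htx : fderiv ℝ (fderiv ℝ h) 0 ((1 : ℝ), (0 : ℝ)) ((0 : ℝ), (1 : ℝ)) ≠ 0)
    {τ : ℝ → ℝ} {V : Set ℝ} (hV : IsOpen V) (h0V : (0 : ℝ) ∈ V) (hτ : ContDiffOn ℝ ∞ τ V)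
    (hτ0 : τ 0 = 0)
    (hgraph : ∀ x ∈ V, (τ x, x) ∈ U ∧ fderiv ℝ h (τ x, x) ((0 : ℝ), (1 : ℝ)) = 0) :
    ∃ η > 0, Ioo (-η) η ⊆ V ∧ InjOn (fun x => h (τ x, x)) (Ioo (-η) η) := by
  set e₁ : ℝ × ℝ := ((1 : ℝ), (0 : ℝ)) with he₁
  set e₂ : ℝ × ℝ := ((0 : ℝ), (1 : ℝ)) with he₂
  have hd1 : ContDiffOn ℝ ∞ (fderiv ℝ h) U := hh.fderiv_of_isOpen hU (by simp)
  have hd2 : ContDiffOn ℝ ∞ (fderiv ℝ (fderiv ℝ h)) U := hd1.fderiv_of_isOpen hU (by simp)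
  -- the curve `c(x) = (τ x, x)` and its velocity
  set c : ℝ → ℝ × ℝ := fun x => (τ x, x) with hc
  have hcU : ∀ x ∈ V, c x ∈ U := fun x hx => (hgraph x hx).1
  have hc0 : c 0 = 0 := by simp [hc, hτ0]
  have hcd : ∀ x ∈ V, HasDerivAt c (deriv τ x • e₁ + e₂) x := by
    intro x hx
    have h1 : HasDerivAt τ (deriv τ x) x :=
      ((hτ.contDiffAt (hV.mem_nhds hx)).differentiableAt (by simp)).hasDerivAt
    have h2 : HasDerivAt (fun x => (τ x, x)) (deriv τ x, (1 : ℝ)) x := h1.prodMk (hasDerivAt_id x)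
    have heq : deriv τ x • e₁ + e₂ = (deriv τ x, (1 : ℝ)) := by
      rw [he₁, he₂, Prod.smul_mk, Prod.mk_add_mk, smul_eq_mul, mul_one, smul_zero, zero_add,
        add_zero]
    rw [heq]
    exact h2
  -- derivatives along the curve of `h`, `h_t`, `h_x`-type quantities
  have hcomp : ∀ {F' : Type} [NormedAddCommGroup F'] [NormedSpace ℝ F'] (Φ : ℝ × ℝ → F'),
      ContDiffOn ℝ ∞ Φ U → ∀ x ∈ V,
        HasDerivAt (fun x => Φ (c x)) (fderiv ℝ Φ (c x) (deriv τ x • e₁ + e₂)) x := by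
    intro F' _ _ Φ hΦ x hx
    have hΦd : HasFDerivAt Φ (fderiv ℝ Φ (c x)) (c x) :=
      ((hΦ.contDiffAt (hU.mem_nhds (hcU x hx))).differentiableAt (by simp)).hasFDerivAt
    exact hΦd.comp_hasDerivAt x (hcd x hx)
  -- (I) differentiating `h_x(c(x)) = 0`: `τ' h_tx + h_xx = 0` along the curve
  set A₁ : ℝ → ℝ := fun x => fderiv ℝ (fderiv ℝ h) (c x) e₁ e₂ with hA₁
  set A₂ : ℝ → ℝ := fun x => fderiv ℝ (fderiv ℝ h) (c x) e₂ e₂ with hA₂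
  have hI : ∀ x ∈ V, deriv τ x * A₁ x + A₂ x = 0 := by
    intro x hx
    have hk : HasDerivAt (fun x => fderiv ℝ h (c x) e₂)
        ((fderiv ℝ (fderiv ℝ h) (c x) (deriv τ x • e₁ + e₂)) e₂) x := by
      have := (hcomp (fderiv ℝ h) hd1 x hx).clm_apply (hasDerivAt_const x e₂)
      simpa using this
    have hzero : deriv (fun x => fderiv ℝ h (c x) e₂) x = 0 := by
      have hev : (fun x => fderiv ℝ h (c x) e₂) =ᶠ[𝓝 x] fun _ => (0 : ℝ) :=
        eventually_of_mem (hV.mem_nhds hx) fun x' hx' => (hgraph x' hx').2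
      rw [hev.deriv_eq, deriv_const]
    rw [hk.deriv, map_add, map_smul] at hzero
    simpa [hA₁, hA₂] using hzero
  -- `τ'(0) = 0`
  have hA₁0 : A₁ 0 = fderiv ℝ (fderiv ℝ h) 0 e₁ e₂ := by
    show fderiv ℝ (fderiv ℝ h) (c 0) e₁ e₂ = _
    rw [hc0]
  have hA₂0 : A₂ 0 = 0 := by
    show fderiv ℝ (fderiv ℝ h) (c 0) e₂ e₂ = 0
    rw [hc0]
    exact hxx
  have hτ'0 : deriv τ 0 = 0 := by
    have h := hI 0 h0V
    rw [hA₂0, add_zero, hA₁0] at h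
    exact (mul_eq_zero.1 h).resolve_right htx
  -- `λ(x) = h(c x)` and `λ' = τ' T` with `T = h_t(c x)`
  set lam : ℝ → ℝ := fun x => h (c x) with hlam
  set T : ℝ → ℝ := fun x => fderiv ℝ h (c x) e₁ with hT
  have hlamd : ∀ x ∈ V, HasDerivAt lam (deriv τ x * T x) x := by
    intro x hx
    have := hcomp h hh x hx
    rw [map_add, map_smul, (hgraph x hx).2, add_zero, smul_eq_mul] at this
    exact this
  -- `T(0) = 0`, `T'(0) = h_tx(0)` (symmetry of second derivatives)
  have hT0 : T 0 = 0 := by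
    show fderiv ℝ h (c 0) e₁ = 0
    rw [hc0]
    exact ht
  have h2le : (2 : WithTop ℕ∞) ≤ ∞ := WithTop.coe_le_coe.2 le_top
  have hsymm : fderiv ℝ (fderiv ℝ h) 0 e₂ e₁ = fderiv ℝ (fderiv ℝ h) 0 e₁ e₂ :=
    (hh.contDiffAt (hU.mem_nhds h0)).isSymmSndFDerivAt
      (by simp only [minSmoothness_of_isRCLikeNormedField]; exact h2le) e₂ e₁
  have hTd : HasDerivAt T (fderiv ℝ (fderiv ℝ h) 0 e₁ e₂) 0 := by
    have := (hcomp (fderiv ℝ h) hd1 0 h0V).clm_apply (hasDerivAt_const (0 : ℝ) e₁)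
    simp only [hτ'0, zero_smul, zero_add, hc0, map_zero, add_zero] at this
    rw [hsymm] at this
    exact this
  -- `A₂(0) = 0`, `A₂'(0) = h_xxx(0)`
  have hA₂d : HasDerivAt A₂ (fderiv ℝ (fderiv ℝ (fderiv ℝ h)) 0 e₂ e₂ e₂) 0 := by
    have h1 := ((hcomp (fderiv ℝ (fderiv ℝ h)) hd2 0 h0V).clm_apply
      (hasDerivAt_const (0 : ℝ) e₂)).clm_apply (hasDerivAt_const (0 : ℝ) e₂)
    simp only [hτ'0, zero_smul, zero_add, hc0, map_zero, add_zero] at h1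
    exact h1
  -- `A₁` is continuous at `0` with `A₁(0) = h_tx(0) ≠ 0`
  have hA₁c : ContinuousAt A₁ 0 := by
    have := ((hcomp (fderiv ℝ (fderiv ℝ h)) hd2 0 h0V).clm_apply
      (hasDerivAt_const (0 : ℝ) e₁)).clm_apply (hasDerivAt_const (0 : ℝ) e₂)
    exact this.continuousAt
  -- slopes: `T(t)/t → h_tx(0)`, `A₂(t)/t → h_xxx(0)`
  have hslT : Tendsto (fun t => t⁻¹ * T t) (𝓝[≠] 0) (𝓝 (fderiv ℝ (fderiv ℝ h) 0 e₁ e₂)) := by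
    have := (hasDerivAt_iff_tendsto_slope_zero).1 hTd
    simpa [hT0] using this
  have hslA : Tendsto (fun t => t⁻¹ * A₂ t) (𝓝[≠] 0)
      (𝓝 (fderiv ℝ (fderiv ℝ (fderiv ℝ h)) 0 e₂ e₂ e₂)) := by
    have := (hasDerivAt_iff_tendsto_slope_zero).1 hA₂d
    simpa [hA₂0] using this
  set a₃ : ℝ := fderiv ℝ (fderiv ℝ (fderiv ℝ h)) 0 e₂ e₂ e₂ with ha₃
  set b₂ : ℝ := fderiv ℝ (fderiv ℝ h) 0 e₁ e₂ with hb₂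
  have hlim : Tendsto (fun t => (t⁻¹ * A₂ t) * (t⁻¹ * T t) / A₁ t) (𝓝[≠] 0)
      (𝓝 (a₃ * b₂ / b₂)) := by
    refine (hslA.mul hslT).div ?_ (by rw [← hA₁0] at htx; simpa [hA₁0] using htx)
    have := hA₁c.tendsto.mono_left (nhdsWithin_le_nhds (s := ({0}ᶜ : Set ℝ)))
    rwa [hA₁0] at this
  have hc₀ : a₃ * b₂ / b₂ = a₃ := by field_simp
  rw [hc₀] at hlim
  -- eventually the normalised slope has the sign of `a₃`
  have hev1 : ∀ᶠ t in 𝓝[≠] (0 : ℝ), 0 < a₃ * ((t⁻¹ * A₂ t) * (t⁻¹ * T t) / A₁ t) := by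
    have h2 : Tendsto (fun t => a₃ * ((t⁻¹ * A₂ t) * (t⁻¹ * T t) / A₁ t)) (𝓝[≠] 0)
        (𝓝 (a₃ * a₃)) := hlim.const_mul a₃
    exact h2.eventually (Ioi_mem_nhds (mul_self_pos.2 hxxx))
  have hev2 : ∀ᶠ t in 𝓝 (0 : ℝ), t ∈ V ∧ A₁ t ≠ 0 := by
    filter_upwards [hV.mem_nhds h0V, hA₁c.eventually_ne (by rw [hA₁0]; exact htx)] with t h1 h2
    exact ⟨h1, h2⟩
  -- the sign of `λ'` off `0`
  have hev3 : ∀ᶠ t in 𝓝 (0 : ℝ), t ∈ V ∧ (t ≠ 0 → 0 < -a₃ * (deriv τ t * T t)) := by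
    rw [eventually_nhdsWithin_iff] at hev1
    filter_upwards [hev1, hev2] with t h1 h2
    refine ⟨h2.1, fun ht0 => ?_⟩
    have h3 := h1 ht0
    have hτ' : deriv τ t = -A₂ t / A₁ t := by
      rw [eq_div_iff h2.2]
      linarith [hI t h2.1]
    have key : -a₃ * (deriv τ t * T t) = t ^ 2 * (a₃ * ((t⁻¹ * A₂ t) * (t⁻¹ * T t) / A₁ t)) := by
      rw [hτ']
      field_simp
    rw [key]
    positivity
  obtain ⟨η, hη, hballη⟩ := Metric.eventually_nhds_iff.1 hev3
  have hIooV : ∀ t ∈ Ioo (-η) η, dist t 0 < η := fun t ht => by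
    rw [dist_zero_right, Real.norm_eq_abs, abs_lt]; exact ht
  refine ⟨η, hη, fun t ht => (hballη (hIooV t ht)).1, ?_⟩
  -- strict monotonicity of `-a₃ λ`
  set μ : ℝ → ℝ := fun t => -a₃ * lam t with hμ
  have hμd : ∀ t ∈ Ioo (-η) η, HasDerivAt μ (-a₃ * (deriv τ t * T t)) t := fun t ht =>
    (hlamd t (hballη (hIooV t ht)).1).const_mul (-a₃)
  have hinj : InjOn μ (Ioo (-η) η) := by
    refine injOn_Ioo_of_deriv_pos_off_zero (fun t ht => (hμd t ht).continuousAt.continuousWithinAt)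
      fun t ht ht0 => ?_
    rw [(hμd t ht).deriv]
    exact (hballη (hIooV t ht)).2 ht0
  intro t ht t' ht' htt'
  have : μ t = μ t' := by simp only [hμ, hlam]; rw [show h (c t) = h (c t') from htt']
  exact hinj ht ht' this

/-! ### The manifold statement -/

/-- The vector `(a, b, 0, 0)` of `ℝ⁴`. [folklore] -/
private def cuspArcPt (a b : ℝ) : 𝔼 4 := WithLp.toLp 2 ![a, b, 0, 0]

/-- Coordinate `0` of `cuspArcPt a b`. [folklore] -/
@[simp] private theorem cuspArcPt_apply_zero (a b : ℝ) : cuspArcPt a b 0 = a := rfl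

/-- Coordinate `1` of `cuspArcPt a b`. [folklore] -/
@[simp] private theorem cuspArcPt_apply_one (a b : ℝ) : cuspArcPt a b 1 = b := rfl

/-- Coordinate `2` of `cuspArcPt a b`. [folklore] -/
@[simp] private theorem cuspArcPt_apply_two (a b : ℝ) : cuspArcPt a b 2 = 0 := rfl

/-- Coordinate `3` of `cuspArcPt a b`. [folklore] -/
@[simp] private theorem cuspArcPt_apply_three (a b : ℝ) : cuspArcPt a b 3 = 0 := rfl

/-- A vector with vanishing last two coordinates is `cuspArcPt` of its first two. [folklore] -/
private theorem eq_cuspArcPt {y : 𝔼 4} (h2 : y 2 = 0) (h3 : y 3 = 0) :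
    y = cuspArcPt (y 0) (y 1) := by
  ext i
  fin_cases i
  · rfl
  · rfl
  · simpa using h2
  · simpa using h3

variable {X : Type*} [TopologicalSpace X] [ChartedSpace (𝔼 4) X]
  {B : Type*} [TopologicalSpace B] [ChartedSpace (𝔼 2) B]

/-- **A generic map is injective on its critical set near a cusp.**  If `g : X → B` has
Whitney cusp charts at `p`, then `g` is injective on the critical points of some neighbourhood
of `p`. [cite: BaykurSaeki2017, §2.1, p. 6] [cite: GolubitskyGuillemin1973, Ch. VI §2] -/
theorem HasManifoldWhitneyCuspCharts.exists_nhds_injOn {g : X → B} {p : X}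
    (hW : HasManifoldWhitneyCuspCharts g p) :
    ∃ U ∈ 𝓝 p, InjOn g (U ∩ {q | ¬ Surjective (mfderiv (𝓡 4) (𝓡 2) g q)}) := by
  obtain ⟨φ, ψ, h, U, ε₂, ε₃, hpφ, hp0, hmaps, hφ, hφs, hψ, hψs, hU, hh, hφU, hε₂, hε₃, hid,
    -, ht, hx, hxx, hxxx, htx⟩ := hW
  have hε₂0 : ε₂ ≠ 0 := by rintro rfl; norm_num at hε₂
  have hε₃0 : ε₃ ≠ 0 := by rintro rfl; norm_num at hε₃
  have h0U : (0 : ℝ × ℝ) ∈ U := by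
    have := hφU p hpφ
    rw [hp0] at this
    exact (by simpa using this : ((0 : ℝ), (0 : ℝ)) ∈ U)
  -- the model and the chart identity
  set G : 𝔼 4 → 𝔼 2 := OneJet.rankOneMap (OneJet.cuspModelFn h ε₂ ε₃) with hG
  set Ω : Set (𝔼 4) := OneJet.baseProj ⁻¹' U with hΩ
  have hΩo : IsOpen Ω := hU.preimage OneJet.baseProj.continuous
  have hGs : ContDiffOn ℝ ∞ G Ω :=
    OneJet.contDiffOn_rankOneMap (OneJet.contDiffOn_cuspModelFn hh ε₂ ε₃)
  have hφΩ : ∀ q ∈ φ.source, φ q ∈ Ω := fun q hq => hφU q hq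
  have hidv : ∀ q ∈ φ.source, ψ (g q) = G (φ q) := by
    intro q hq
    obtain ⟨h0', h1'⟩ := hid q hq
    ext i
    fin_cases i
    · show ψ (g q) 0 = OneJet.rankOneMap _ (φ q) 0
      rw [OneJet.rankOneMap_apply_zero, h0']
    · show ψ (g q) 1 = OneJet.rankOneMap _ (φ q) 1
      rw [OneJet.rankOneMap_apply_one, h1']
      rfl
  have hGf : ∀ q ∈ φ.source, G =ᶠ[𝓝 (φ q)] (ψ ∘ g ∘ φ.symm) := by
    intro q hq
    filter_upwards [φ.open_target.mem_nhds (φ.map_source hq)] with y hy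
    show G y = ψ (g (φ.symm y))
    rw [hidv (φ.symm y) (φ.map_target hy), φ.right_inv hy]
  have hcrit_iff : ∀ q ∈ φ.source, (¬ Surjective (mfderiv (𝓡 4) (𝓡 2) g q) ↔
      fderiv ℝ h ((φ q) 0, (φ q) 1) ((0 : ℝ), (1 : ℝ)) = 0 ∧ ε₂ * (φ q) 2 = 0 ∧
        ε₃ * (φ q) 3 = 0) := by
    intro q hq
    have hGd : DifferentiableAt ℝ G (φ q) :=
      (hGs.contDiffAt (hΩo.mem_nhds (hφΩ q hq))).differentiableAt (by simp)
    rw [surjective_mfderiv_iff_of_localRepresentative hφ hφs hψ hψs hmaps hq hGd (hGf q hq)]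
    exact critical_cuspModel_iff hU hh (hφΩ q hq)
  -- the planar curve and the injectivity interval
  obtain ⟨V, τ, W, hVo, h0V, hτs, hτ0, hτgraph, hWo, h0W, -, hWuniq⟩ :=
    exists_cuspCritCurve hU h0U hh hx htx
  obtain ⟨η, hη, hηV, hinj⟩ :=
    exists_injOn_cuspValue hU h0U hh ht hxx hxxx htx hVo h0V hτs hτ0 hτgraph
  -- the value of `g` at a critical point of the chart, read through `λ`
  have hval : ∀ q ∈ φ.source, fderiv ℝ h ((φ q) 0, (φ q) 1) ((0 : ℝ), (1 : ℝ)) = 0 →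
      φ q 2 = 0 → φ q 3 = 0 → ((φ q) 0, (φ q) 1) ∈ W →
      φ q 1 ∈ V ∧ φ q = cuspArcPt (τ (φ q 1)) (φ q 1) ∧
        ψ (g q) 1 = h (τ (φ q 1), φ q 1) := by
    intro q hq hxq hy2 hy3 hqW
    obtain ⟨hV1, hτq⟩ := hWuniq ((φ q) 0, (φ q) 1) hqW hxq
    have hφq : φ q = cuspArcPt (τ (φ q 1)) (φ q 1) := by
      rw [eq_cuspArcPt hy2 hy3]
      simpa using congrArg (fun r : ℝ × ℝ => cuspArcPt r.1 r.2) hτq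
    refine ⟨hV1, hφq, ?_⟩
    rw [hidv q hq, hG, OneJet.rankOneMap_apply_one]
    have h0q : (φ q) 0 = τ (φ q 1) := by simpa using congrArg Prod.fst hτq
    simp only [OneJet.cuspModelFn, hy2, hy3, h0q]
    ring
  -- the neighbourhood
  set N : Set X := φ.source ∩ φ ⁻¹' (Ω ∩ OneJet.baseProj ⁻¹' W ∩ {y | y 1 ∈ Ioo (-η) η}) with hN
  have hNn : N ∈ 𝓝 p := by
    have ho : IsOpen (Ω ∩ OneJet.baseProj ⁻¹' W ∩ {y : 𝔼 4 | y 1 ∈ Ioo (-η) η}) :=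
      (hΩo.inter (hWo.preimage OneJet.baseProj.continuous)).inter
        (isOpen_Ioo.preimage (EuclideanSpace.proj (1 : Fin 4) : 𝔼 4 →L[ℝ] ℝ).continuous)
    refine (φ.continuousOn.isOpen_inter_preimage φ.open_source ho).mem_nhds ⟨hpφ, ?_⟩
    rw [mem_preimage, hp0]
    refine ⟨⟨?_, ?_⟩, ?_⟩
    · show OneJet.baseProj (0 : 𝔼 4) ∈ U
      rw [map_zero]; exact h0U
    · show OneJet.baseProj (0 : 𝔼 4) ∈ W
      rw [map_zero]; exact h0W
    · show (0 : 𝔼 4) 1 ∈ Ioo (-η) η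
      simpa using hη
  refine ⟨N, hNn, ?_⟩
  rintro q ⟨⟨hq, ⟨⟨-, hqW⟩, hq1⟩⟩, hqc⟩ q' ⟨⟨hq', ⟨⟨-, hqW'⟩, hq1'⟩⟩, hqc'⟩ hgg
  rw [mem_setOf_eq, hcrit_iff q hq] at hqc
  rw [mem_setOf_eq, hcrit_iff q' hq'] at hqc'
  obtain ⟨hxq, h2, h3⟩ := hqc
  obtain ⟨hxq', h2', h3'⟩ := hqc'
  have hy2 : φ q 2 = 0 := (mul_eq_zero.1 h2).resolve_left hε₂0
  have hy3 : φ q 3 = 0 := (mul_eq_zero.1 h3).resolve_left hε₃0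
  have hy2' : φ q' 2 = 0 := (mul_eq_zero.1 h2').resolve_left hε₂0
  have hy3' : φ q' 3 = 0 := (mul_eq_zero.1 h3').resolve_left hε₃0
  obtain ⟨-, hφq, hv⟩ := hval q hq hxq hy2 hy3 hqW
  obtain ⟨-, hφq', hv'⟩ := hval q' hq' hxq' hy2' hy3' hqW'
  have hlam : h (τ (φ q 1), φ q 1) = h (τ (φ q' 1), φ q' 1) := by rw [← hv, ← hv', hgg]
  have h11 : φ q 1 = φ q' 1 := hinj hq1 hq1' hlam
  have hφφ : φ q = φ q' := by rw [hφq, hφq', h11]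
  rw [← φ.left_inv hq, ← φ.left_inv hq', hφφ]

end Literature.Topology.FourManifolds
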